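/-
Copyright (c) 2026 the pub-hodgecm-mathlib formalisation cell (harness21).  Prover seat hodgecm-mathlib-LH4-p06 (g5), Track A «(D-RAM) FOUR-FRAME», unit U2H, census leaf
(ρ2b′-X) `stub_U2H_fixedPointCensus_typeTwo_unit0` — T5c «TORIC LEVEL CENSUS, M∕E-RAMIFIED»: (D3-LAW) PACKAGED — the RamM top bit per class in the shape of LH4-p04 (g4)'s
T5s-RamM `hvTop` letter `[2j + d_E ≤ 2jλ + 1] ∧ [k′ + 2 ≤ 2g ∨ ε = side]`.  2026-09-04.
-/
import Summits.HodgeConjecture.HodgeConjecture.Theorems.F0P3cDyRamToricLevelCensusRamMTopLawSide   -- ★ p857841 (this seat): classes T∕E, threshold, exclusivity, constancy; brings ★ LAW-i p857816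
import HarnessLib

/-!
# T5c (D3-LAW) packaged: the RamM top bit per class — `alive ⟺ [2c′ + dτ + 2d_K ≤ 2jλ + d_ρ + 2] ∧ [k′ + 2 ≤ dΘ ∨ alive at the reference far cell]`

Cell `hodgecm-mathlib` (D-0151), FLOOR 0, crux H413 = `stmt-HodgeConjecture-24833`; squad F0∕P3c∕LH4; lane `--supports stmt-HodgeConjecture-24833 --as helper` (count-neutral).
THEOREMS ONLY (no `def`, no instance, no notation, no `sorry`, default heartbeats).  Socket served: LH4-p04 (g4)'s T5s-RamM `hvTop` (★ p857711) alive-clause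
`2j + (g+s0) ≤ 2jl + 1 ∧ (j + a + 2 ≤ m + s0 + 2g ∨ ε = side)` for the (D3) bit of ★ p857665∕p857741, per CLASS (T = translator class = `+` side; E = non-norm anchored class
= `−` side), in torus currency (§0 of ★ `…TopLawSide` + ★ `topBit_iff_exists_isOrd_of_translator ∕ _of_anchor` turn it into the literal (D3) bit):
* §1 `v_eq_exp_four_mul_of_fixed_fixed` — the `4ℤ`-parity letter `hF4` of ★ LAW-i DISCHARGED from the third-field package (`f = jK f′`, `σ′f′ = f′`).
* §2 **`twistNear_iff_depth_of_lt_threshold`** ∕ **`anchoredNear_iff_depth_of_lt_threshold`** — BELOW the threshold (`k′ + 2 ≤ dΘ`) both classes are alive iff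
  `2c′ + dτ + 2d_K ≤ 2jλ + d_ρ + 2` (★ LAW-i + ★ §2∕§3 of `…TopLawSide`).
* §3 **`twistNear_iff_depth_and_ref_of_threshold_le`** ∕ **`anchoredNear_iff_depth_and_ref_of_threshold_le`** — BEYOND the threshold a class is alive at `c′` iff the depth
  inequality holds AND the same class is alive at any one admissible far REFERENCE cell `c″` (constancy along the diagonal): this is `ε = side` with `ε :=` the class alive at the
  reference cell (exactly one is, ★ exclusivity + ★ §2) — its identification with the Hilbert-symbol sign is MAP seam S9-R, not this file.
Radii are matched by `2(d′ + k′) = 2c′ + d_ρ` (`k′` = LH4-p04's K♮-level `c′ − s0`); the unit-coset hypothesis of ★ §2 is the token inequality `2d′ + 2m ≤ 2jλ + d_ρ` (`ℓ ≥ s0`).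
* §4 (ED. 2, append-only) `exists_v_eq_exp_two_mul_of_tauFixed`, **`isRamifiedQuadraticDatum_tau`** — the frame letter `hDτ` DISCHARGED from the `ρ`-datum, `Θ`, the
  third-field package and the single new letter `|α − τα| = |α|^{dτ}` (`1 ≤ dτ`).
* §5 (ED. 3, append-only) **`topBit_iff_twistNear_ramified`** ∕ **`topBit_iff_anchoredNear_ramified`** — the BRIDGES: the literal (D3) bit of ★ p857665 (translator ∕ anchor)
  IS the class-T ∕ class-E inequality of §2–§3, so ★ value × ★ bridge × ★ law is the whole RamM top-cell row.
HONEST LABEL.  Count-neutral (`--supports`); unconditional local algebra; nothing of (ρ2b′-X) is asserted — `HC_CM` is proved only modulo the 7 printed citations (2 remaining named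
inputs: hLiu418 = `stmt-HodgeConjecture-24832`, h413 = `stmt-HodgeConjecture-24833`) until rung 0 closes.

## References
* [Serre1979] J.-P. Serre, *Local Fields*, GTM 67 (1979): Ch. V §3 Prop. 5, Cor. 3; Ch. X §1.
* [Jacobowitz1962] R. Jacobowitz, *Hermitian forms over local fields*, Amer. J. Math. 84 (1962): §4.
* [Kottwitz1986BaseChangeUnits] R. E. Kottwitz, *Base change for unit elements of Hecke algebras*, Compositio Math. 60 (1986): §1 pp. 240–241.
-/

set_option autoImplicit false

noncomputable section

namespace Summit.HodgeConjecture.HodgeConjecture.Cruxes.H413.F0P3cDyRamToricLevelCensusRamM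

open WithZero IsLocalRing
open scoped Valued
open Literature.NumberTheory.Automorphic.UnitaryThreeFourFrame (IsRamifiedQuadraticDatum)
open Literature.NumberTheory.LocalFields.QuadraticOrder Literature.NumberTheory.LocalFields.WildQuadraticDatum

variable {K : Type} [Field K] [Valued K ℤᵐ⁰] {ρ Θ τ : K →+* K} {α ϖE : K} {dρ t dτ tτ : ℕ}
variable {K' : Type*} [Field K'] [Valued K' ℤᵐ⁰] {σ' : K' →+* K'} {π' : K'} {d' : ℕ}

/-! ## §1 The `4ℤ`-parity of `F` from the third-field package -/

/-- **`F`-ELEMENTS HAVE `M`-VALUATION IN `4ℤ`**: an element fixed by `ρ` and by `τ = Θρ` is `Θ`-fixed, hence `jK f′` with `σ′f′ = f′`, `|f′| = exp(2n)` on the third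
field, and `|jK x| = |x|²` along the order-compatible `jK` (`|jK π′| = exp(−2)`). [cite: Serre1979, Ch. II §2] -/
theorem v_eq_exp_four_mul_of_fixed_fixed (hτ : ∀ x, τ x = Θ (ρ x))
    (hfix' : ∀ x : K', σ' x = x → x ≠ 0 → ∃ n : ℤ, Valued.v x = exp (2 * n)) (hπ' : Valued.v π' = exp (-1 : ℤ))
    (jK : K' →+* K) (hjle : ∀ x y : K', Valued.v (jK x) ≤ Valued.v (jK y) ↔ Valued.v x ≤ Valued.v y)
    (hjfix : ∀ z : K, Θ z = z → ∃ x, jK x = z) (hjσ : ∀ x, jK (σ' x) = ρ (jK x)) (hjπ : Valued.v (jK π') = exp (-2 : ℤ))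
    (f : K) (hρf : ρ f = f) (hτf : τ f = f) (hf0 : f ≠ 0) : ∃ n : ℤ, Valued.v f = exp (4 * n) := by
  have hΘf : Θ f = f := by
    have h := hτf
    rw [hτ, hρf] at h
    exact h
  obtain ⟨f', rfl⟩ := hjfix f hΘf
  have hσf' : σ' f' = f' := jK.injective (by rw [hjσ, hρf])
  have hf'0 : f' ≠ 0 := fun h0 => hf0 (by rw [h0, map_zero])
  obtain ⟨n, hn⟩ := hfix' f' hσf' hf'0
  have hπ0 : π' ≠ 0 := fun h0 => by rw [h0, map_zero] at hπ'; exact exp_ne_zero hπ'.symm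
  -- `|f′| = |π′^{−2n}|`, transported: `|jK f′| = |jK π′|^{−2n} = exp(4n)`
  have hy : Valued.v f' = Valued.v (π' ^ (-(2 * n))) := by
    rw [hn, map_zpow₀, hπ', ← exp_zsmul, smul_eq_mul]; congr 1; ring
  refine ⟨n, le_antisymm ?_ ?_⟩
  · refine ((hjle f' (π' ^ (-(2 * n)))).2 hy.le).trans_eq ?_
    rw [map_zpow₀, map_zpow₀, hjπ, ← exp_zsmul, smul_eq_mul]; congr 1; ring
  · refine (le_of_eq ?_).trans ((hjle (π' ^ (-(2 * n))) f').2 hy.ge)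
    rw [map_zpow₀, map_zpow₀, hjπ, ← exp_zsmul, smul_eq_mul]; congr 1; ring

/-! ## §2 Below the threshold: both classes are alive iff the depth inequality holds -/

/-- The unit-coset hypothesis of ★ `twist_near_or_anchored_of_thetaFixed_near` from the tokens: `|κ − x| ≤ exp(−(2c′ + d_ρ))` with `2d′ ≤ 2c′ + d_ρ` and
`|κ − 1| = exp(2m − 2jλ − d_ρ) ≤ exp(−2d′)` give `|x − 1| ≤ exp(−2d′)`. [cite: Serre1979, Ch. V §1] -/
theorem v_sub_one_le_of_near_kappa (hD : IsRamifiedQuadraticDatum ρ α dρ t) (hϖE : Valued.v ϖE = exp (-2 : ℤ))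
    {μ : K} {m jl : ℕ} (hμ : Valued.v μ = Valued.v ϖE ^ m) (hjl : Valued.v (μ - ρ μ) = Valued.v (ϖE ^ jl * (α - ρ α)))
    {c' : ℕ} (hc2 : 2 * (d' : ℤ) ≤ 2 * c' + dρ) (hℓ : 2 * (d' : ℤ) + 2 * m ≤ 2 * jl + dρ)
    {x : K} (hκx : Valued.v (ρ μ / μ - x) ≤ exp (-(2 * (c' : ℤ) + dρ))) : Valued.v (x - 1) ≤ exp (-(2 * (d' : ℤ))) := by
  have hκ1 : Valued.v (1 - ρ μ / μ) = exp (2 * (m : ℤ) - 2 * jl - dρ) := v_one_sub_twist_eq_ramified hD hϖE hμ hjl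
  have hsplit : x - 1 = -((ρ μ / μ - x) + (1 - ρ μ / μ)) := by ring
  rw [hsplit, Valuation.map_neg]
  refine (Valuation.map_add _ _ _).trans (max_le (hκx.trans ?_) (hκ1.le.trans ?_)) <;> rw [exp_le_exp] <;> omega

/-- **CLASS T BELOW THE THRESHOLD.**  Frame of ★ LAW-i (`ρ`-datum, `τ = Θρ` with its datum, the fourth field `P, d_K`), the third-field package with the `Θ`-datum and the
base-unit token `hFN`, a `Θ`-fixed unit NON-norm `n₀` (index two), `M` complete with finite residue field; tokens `|μ| = |ϖE|^m`, `|μ − ρμ| = |ϖE^{jλ}(α − ρα)|` for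
`μ = λ − u`; a cell radius `c′` with `dτ ≤ 2c′`, K♮-level `k′` (`2(d′ + k′) = 2c′ + d_ρ`) BELOW the threshold (`k′ + 2 ≤ dΘ`), and `2d′ + 2m ≤ 2jλ + d_ρ`:
**`(∃ ω ∈ U_M, |κ·t(ω) − 1| ≤ exp(−(2c′ + d_ρ))) ⟺ 2c′ + dτ + 2d_K ≤ 2jλ + d_ρ + 2`.** [cite: Serre1979, Ch. V §3 Prop. 5, Cor. 3] [cite: Kottwitz1986BaseChangeUnits, §1 pp. 240–241] -/
theorem twistNear_iff_depth_of_lt_threshold [CompleteSpace K] [Finite 𝓀[K]]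
    (hD : IsRamifiedQuadraticDatum ρ α dρ t) (hΘρ : ∀ x, Θ (ρ x) = ρ (Θ x)) (hvΘ : ∀ x, Valued.v (Θ x) = Valued.v x)
    (hτ : ∀ x, τ x = Θ (ρ x)) (hDτ : IsRamifiedQuadraticDatum τ α dτ tτ)
    {P : K} (hτP : τ P = P) (hP : Valued.v P = exp (-2 : ℤ)) {dK : ℕ} (hdK : Valued.v (P - ρ P) = exp (-(2 * (dK : ℤ))))
    (hσ' : ∀ x, σ' (σ' x) = x) (hvσ' : ∀ x, Valued.v (σ' x) = Valued.v x) (hfix' : ∀ x : K', σ' x = x → x ≠ 0 → ∃ n : ℤ, Valued.v x = exp (2 * n))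
    (hπ' : Valued.v π' = exp (-1 : ℤ)) (hdd' : Valued.v (π' - σ' π') = Valued.v π' ^ d')
    (jK : K' →+* K) (hjle : ∀ x y : K', Valued.v (jK x) ≤ Valued.v (jK y) ↔ Valued.v x ≤ Valued.v y) (hjΘ : ∀ x, Θ (jK x) = jK x)
    (hjfix : ∀ z : K, Θ z = z → ∃ x, jK x = z) (hjσ : ∀ x, jK (σ' x) = ρ (jK x)) (hjπ : Valued.v (jK π') = exp (-2 : ℤ))
    {ϖ : K} {dΘ tΘ : ℕ} (hDΘ : IsRamifiedQuadraticDatum Θ ϖ dΘ tΘ)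
    (hFN : ∀ f : K, ρ f = f → Θ f = f → Valued.v f = 1 → ∃ x : K, x * Θ x = f)
    {n₀ : K} (hΘn₀ : Θ n₀ = n₀) (hn₀1 : Valued.v n₀ = 1) (hn₀N : ¬ ∃ z : K, z * Θ z = n₀)
    (hϖE : Valued.v ϖE = exp (-2 : ℤ)) {lam u : K} (hlam : lam * Θ lam = 1) (hu : ρ u = u) (hu1 : u * Θ u = 1)
    {m jl : ℕ} (hμ : Valued.v (lam - u) = Valued.v ϖE ^ m) (hjl : Valued.v ((lam - u) - ρ (lam - u)) = Valued.v (ϖE ^ jl * (α - ρ α)))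
    {c' k' : ℕ} (hc : dτ ≤ 2 * c') (hk' : 2 * ((d' : ℤ) + k') = 2 * c' + dρ) (hk : k' + 2 ≤ dΘ) (hℓ : 2 * (d' : ℤ) + 2 * m ≤ 2 * jl + dρ) :
    (∃ ω : K, Valued.v ω = 1 ∧ Valued.v (ρ (lam - u) / (lam - u) * (ρ (ω * Θ ω) / (ω * Θ ω)) - 1) ≤ exp (-(2 * (c' : ℤ) + dρ))) ↔
      2 * (c' : ℤ) + dτ + 2 * dK ≤ 2 * jl + dρ + 2 := by
  obtain ⟨hρρ, hvρ, -, -, -, -, -⟩ := id hD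
  have hΘΘ := hDΘ.1
  have hF4 := v_eq_exp_four_mul_of_fixed_fixed hτ hfix' hπ' jK hjle hjfix hjσ hjπ
  have hlaw := exists_thetaFixed_normOne_near_iff_ramified hD hΘΘ hΘρ hvΘ hτ hDτ hτP hP hdK hF4 hϖE hlam hu hu1 hjl hc
  have hR : Valued.v (jK π' ^ (d' + k')) = exp (-(2 * (c' : ℤ) + dρ)) := by
    rw [v_map_pow_eq_exp_neg_two_mul jK hjπ]; congr 1; push_cast; omega
  constructor
  · rintro ⟨ω, hω, hle⟩
    have hω0 : ω ≠ 0 := fun h0 => by rw [h0, map_zero] at hω; exact zero_ne_one hω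
    exact hlaw.1 (exists_thetaFixed_normOne_near_of_twist hρρ hvρ hΘρ (by rw [map_mul, hΘΘ, mul_comm])
      (mul_ne_zero hω0 ((map_ne_zero Θ).2 hω0)) hle)
  · intro hdepth
    obtain ⟨x, hΘx, hx, hκx⟩ := hlaw.2 hdepth
    have hx1 := v_sub_one_le_of_near_kappa hD hϖE hμ hjl (c' := c') (by omega) hℓ hκx
    rcases twist_near_or_anchored_of_thetaFixed_near hvρ hvΘ hσ' hvσ' hfix' hπ' hdd' jK hjle hjΘ hjfix hjσ hjπ hDΘ hΘn₀ hn₀1 hn₀N hΘx hx hκx hx1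
      with hT | hE
    · exact hT
    · rw [← hR] at hE ⊢
      exact (twist_near_iff_anchored_of_lt_threshold hvρ hvΘ hσ' hvσ' hfix' hπ' hdd' jK hjle hjΘ hjfix hjσ hjπ hDΘ hFN hΘn₀ hn₀1 hn₀N hk _).2 hE

/-- **CLASS E BELOW THE THRESHOLD**: the same statement for the anchored class `∃ ω ∈ U_M, |κ·ψ(n₀)·t(ω) − 1| ≤ exp(−(2c′ + d_ρ))`. [cite: Serre1979, Ch. V §3 Prop. 5, Cor. 3] -/
theorem anchoredNear_iff_depth_of_lt_threshold [CompleteSpace K] [Finite 𝓀[K]]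
    (hD : IsRamifiedQuadraticDatum ρ α dρ t) (hΘρ : ∀ x, Θ (ρ x) = ρ (Θ x)) (hvΘ : ∀ x, Valued.v (Θ x) = Valued.v x)
    (hτ : ∀ x, τ x = Θ (ρ x)) (hDτ : IsRamifiedQuadraticDatum τ α dτ tτ)
    {P : K} (hτP : τ P = P) (hP : Valued.v P = exp (-2 : ℤ)) {dK : ℕ} (hdK : Valued.v (P - ρ P) = exp (-(2 * (dK : ℤ))))
    (hσ' : ∀ x, σ' (σ' x) = x) (hvσ' : ∀ x, Valued.v (σ' x) = Valued.v x) (hfix' : ∀ x : K', σ' x = x → x ≠ 0 → ∃ n : ℤ, Valued.v x = exp (2 * n))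
    (hπ' : Valued.v π' = exp (-1 : ℤ)) (hdd' : Valued.v (π' - σ' π') = Valued.v π' ^ d')
    (jK : K' →+* K) (hjle : ∀ x y : K', Valued.v (jK x) ≤ Valued.v (jK y) ↔ Valued.v x ≤ Valued.v y) (hjΘ : ∀ x, Θ (jK x) = jK x)
    (hjfix : ∀ z : K, Θ z = z → ∃ x, jK x = z) (hjσ : ∀ x, jK (σ' x) = ρ (jK x)) (hjπ : Valued.v (jK π') = exp (-2 : ℤ))
    {ϖ : K} {dΘ tΘ : ℕ} (hDΘ : IsRamifiedQuadraticDatum Θ ϖ dΘ tΘ)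
    (hFN : ∀ f : K, ρ f = f → Θ f = f → Valued.v f = 1 → ∃ x : K, x * Θ x = f)
    {n₀ : K} (hΘn₀ : Θ n₀ = n₀) (hn₀1 : Valued.v n₀ = 1) (hn₀N : ¬ ∃ z : K, z * Θ z = n₀)
    (hϖE : Valued.v ϖE = exp (-2 : ℤ)) {lam u : K} (hlam : lam * Θ lam = 1) (hu : ρ u = u) (hu1 : u * Θ u = 1)
    {m jl : ℕ} (hμ : Valued.v (lam - u) = Valued.v ϖE ^ m) (hjl : Valued.v ((lam - u) - ρ (lam - u)) = Valued.v (ϖE ^ jl * (α - ρ α)))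
    {c' k' : ℕ} (hc : dτ ≤ 2 * c') (hk' : 2 * ((d' : ℤ) + k') = 2 * c' + dρ) (hk : k' + 2 ≤ dΘ) (hℓ : 2 * (d' : ℤ) + 2 * m ≤ 2 * jl + dρ) :
    (∃ ω : K, Valued.v ω = 1 ∧
        Valued.v (ρ (lam - u) / (lam - u) * (ρ n₀ / n₀) * (ρ (ω * Θ ω) / (ω * Θ ω)) - 1) ≤ exp (-(2 * (c' : ℤ) + dρ))) ↔
      2 * (c' : ℤ) + dτ + 2 * dK ≤ 2 * jl + dρ + 2 := by
  obtain ⟨-, hvρ, -, -, -, -, -⟩ := id hD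
  have hR : Valued.v (jK π' ^ (d' + k')) = exp (-(2 * (c' : ℤ) + dρ)) := by
    rw [v_map_pow_eq_exp_neg_two_mul jK hjπ]; congr 1; push_cast; omega
  rw [← twistNear_iff_depth_of_lt_threshold hD hΘρ hvΘ hτ hDτ hτP hP hdK hσ' hvσ' hfix' hπ' hdd' jK hjle hjΘ hjfix hjσ hjπ hDΘ hFN hΘn₀ hn₀1 hn₀N
    hϖE hlam hu hu1 hμ hjl hc hk' hk hℓ, ← hR]
  exact (twist_near_iff_anchored_of_lt_threshold hvρ hvΘ hσ' hvσ' hfix' hπ' hdd' jK hjle hjΘ hjfix hjσ hjπ hDΘ hFN hΘn₀ hn₀1 hn₀N hk _).symm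

/-! ## §3 Beyond the threshold: alive iff the depth inequality holds and the same class is alive at the reference far cell -/

/-- **CLASS T BEYOND THE THRESHOLD, AGAINST A REFERENCE FAR CELL.**  Same frame; the cell `(c′, k′)` and a REFERENCE cell `(c″, k″)` are both beyond the threshold
(`dΘ ≤ k′ + 1`, `dΘ ≤ k″ + 1`), and the reference cell is admissible (`2c″ + dτ + 2d_K ≤ 2jλ + d_ρ + 2`).  Then
**`(class T at c′) ⟺ (2c′ + dτ + 2d_K ≤ 2jλ + d_ρ + 2) ∧ (class T at c″)`** — the one-sided far cells of the diagonal all live on the SAME side (★ constancy), namely the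
side of the reference cell. [cite: Serre1979, Ch. V §3 Prop. 5, Cor. 3] [cite: Kottwitz1986BaseChangeUnits, §1 pp. 240–241] -/
theorem twistNear_iff_depth_and_ref_of_threshold_le [CompleteSpace K] [Finite 𝓀[K]]
    (hD : IsRamifiedQuadraticDatum ρ α dρ t) (hΘρ : ∀ x, Θ (ρ x) = ρ (Θ x)) (hvΘ : ∀ x, Valued.v (Θ x) = Valued.v x)
    (hτ : ∀ x, τ x = Θ (ρ x)) (hDτ : IsRamifiedQuadraticDatum τ α dτ tτ)
    {P : K} (hτP : τ P = P) (hP : Valued.v P = exp (-2 : ℤ)) {dK : ℕ} (hdK : Valued.v (P - ρ P) = exp (-(2 * (dK : ℤ))))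
    (hσ' : ∀ x, σ' (σ' x) = x) (hvσ' : ∀ x, Valued.v (σ' x) = Valued.v x) (hfix' : ∀ x : K', σ' x = x → x ≠ 0 → ∃ n : ℤ, Valued.v x = exp (2 * n))
    (hπ' : Valued.v π' = exp (-1 : ℤ)) (hdd' : Valued.v (π' - σ' π') = Valued.v π' ^ d')
    (jK : K' →+* K) (hjle : ∀ x y : K', Valued.v (jK x) ≤ Valued.v (jK y) ↔ Valued.v x ≤ Valued.v y) (hjΘ : ∀ x, Θ (jK x) = jK x)
    (hjfix : ∀ z : K, Θ z = z → ∃ x, jK x = z) (hjσ : ∀ x, jK (σ' x) = ρ (jK x)) (hjπ : Valued.v (jK π') = exp (-2 : ℤ))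
    {ϖ : K} {dΘ tΘ : ℕ} (hDΘ : IsRamifiedQuadraticDatum Θ ϖ dΘ tΘ)
    (hFN : ∀ f : K, ρ f = f → Θ f = f → Valued.v f = 1 → ∃ x : K, x * Θ x = f)
    {n₀ : K} (hΘn₀ : Θ n₀ = n₀) (hn₀1 : Valued.v n₀ = 1) (hn₀N : ¬ ∃ z : K, z * Θ z = n₀)
    (hϖE : Valued.v ϖE = exp (-2 : ℤ)) {lam u : K} (hlam : lam * Θ lam = 1) (hu : ρ u = u) (hu1 : u * Θ u = 1)
    {m jl : ℕ} (hμ : Valued.v (lam - u) = Valued.v ϖE ^ m) (hjl : Valued.v ((lam - u) - ρ (lam - u)) = Valued.v (ϖE ^ jl * (α - ρ α)))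
    (hℓ : 2 * (d' : ℤ) + 2 * m ≤ 2 * jl + dρ)
    {c' k' : ℕ} (hc : dτ ≤ 2 * c') (hk' : 2 * ((d' : ℤ) + k') = 2 * c' + dρ) (hk : dΘ ≤ k' + 1)
    {c'' k'' : ℕ} (hc'' : dτ ≤ 2 * c'') (hk'' : 2 * ((d' : ℤ) + k'') = 2 * c'' + dρ) (hkr : dΘ ≤ k'' + 1)
    (hadm : 2 * (c'' : ℤ) + dτ + 2 * dK ≤ 2 * jl + dρ + 2) :
    (∃ ω : K, Valued.v ω = 1 ∧ Valued.v (ρ (lam - u) / (lam - u) * (ρ (ω * Θ ω) / (ω * Θ ω)) - 1) ≤ exp (-(2 * (c' : ℤ) + dρ))) ↔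
      2 * (c' : ℤ) + dτ + 2 * dK ≤ 2 * jl + dρ + 2 ∧
        ∃ ω : K, Valued.v ω = 1 ∧ Valued.v (ρ (lam - u) / (lam - u) * (ρ (ω * Θ ω) / (ω * Θ ω)) - 1) ≤ exp (-(2 * (c'' : ℤ) + dρ)) := by
  obtain ⟨hρρ, hvρ, -, -, -, -, -⟩ := id hD
  have hΘΘ := hDΘ.1
  have hF4 := v_eq_exp_four_mul_of_fixed_fixed hτ hfix' hπ' jK hjle hjfix hjσ hjπ
  have hμ0 : lam - u ≠ 0 := fun h0 => by
    rw [h0, map_zero, v_varpiE_pow hϖE] at hμ; exact exp_ne_zero hμ.symm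
  have hκ1 : Valued.v (ρ (lam - u) / (lam - u)) = 1 := (token_twist_mu hρρ hvρ hμ0).2
  have hlaw := fun {c : ℕ} (hcc : dτ ≤ 2 * c) =>
    exists_thetaFixed_normOne_near_iff_ramified hD hΘΘ hΘρ hvΘ hτ hDτ hτP hP hdK hF4 hϖE hlam hu hu1 hjl hcc
  have hR' : Valued.v (jK π' ^ (d' + k')) = exp (-(2 * (c' : ℤ) + dρ)) := by
    rw [v_map_pow_eq_exp_neg_two_mul jK hjπ]; congr 1; push_cast; omega
  have hR'' : Valued.v (jK π' ^ (d' + k'')) = exp (-(2 * (c'' : ℤ) + dρ)) := by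
    rw [v_map_pow_eq_exp_neg_two_mul jK hjπ]; congr 1; push_cast; omega
  -- near `T♮` at an admissible cell gives class T or class E there
  have hTE : ∀ {c k : ℕ}, dτ ≤ 2 * c → 2 * ((d' : ℤ) + k) = 2 * c + dρ → 2 * (c : ℤ) + dτ + 2 * dK ≤ 2 * jl + dρ + 2 →
      (∃ ω : K, Valued.v ω = 1 ∧ Valued.v (ρ (lam - u) / (lam - u) * (ρ (ω * Θ ω) / (ω * Θ ω)) - 1) ≤ Valued.v (jK π' ^ (d' + k))) ∨
        ∃ ω : K, Valued.v ω = 1 ∧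
          Valued.v (ρ (lam - u) / (lam - u) * (ρ n₀ / n₀) * (ρ (ω * Θ ω) / (ω * Θ ω)) - 1) ≤ Valued.v (jK π' ^ (d' + k)) :=
    fun {c k} hcc hkk hadmc => by
      obtain ⟨x, hΘx, hx, hκx⟩ := (hlaw hcc).2 hadmc
      have hx1 := v_sub_one_le_of_near_kappa hD hϖE hμ hjl (c' := c) (by omega) hℓ hκx
      have hRc : Valued.v (jK π' ^ (d' + k)) = exp (-(2 * (c : ℤ) + dρ)) := by
        rw [v_map_pow_eq_exp_neg_two_mul jK hjπ]; congr 1; push_cast; omega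
      rw [hRc]
      exact twist_near_or_anchored_of_thetaFixed_near hvρ hvΘ hσ' hvσ' hfix' hπ' hdd' jK hjle hjΘ hjfix hjσ hjπ hDΘ hΘn₀ hn₀1 hn₀N hΘx hx hκx hx1
  constructor
  · rintro ⟨ω, hω, hle⟩
    have hω0 : ω ≠ 0 := fun h0 => by rw [h0, map_zero] at hω; exact zero_ne_one hω
    have hadm' : 2 * (c' : ℤ) + dτ + 2 * dK ≤ 2 * jl + dρ + 2 :=
      (hlaw hc).1 (exists_thetaFixed_normOne_near_of_twist hρρ hvρ hΘρ (by rw [map_mul, hΘΘ, mul_comm])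
        (mul_ne_zero hω0 ((map_ne_zero Θ).2 hω0)) hle)
    refine ⟨hadm', ?_⟩
    rcases le_total k' k'' with hkk | hkk
    · -- the reference cell is deeper: constancy from `c′` to `c″`
      rw [← hR'']
      exact twist_near_of_twist_near_of_near hvρ hvΘ hσ' hvσ' hfix' hπ' hdd' jK hjle hjΘ hjfix hjσ hjπ hDΘ hFN hΘn₀ hn₀1 hn₀N hk hkk hκ1
        ⟨ω, hω, by rw [hR']; exact hle⟩ (hTE hc'' hk'' hadm)
    · -- the reference cell is shallower: monotonicity
      refine ⟨ω, hω, hle.trans ?_⟩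
      rw [exp_le_exp]; omega
  · rintro ⟨hadm', ω, hω, hle⟩
    rcases le_total k'' k' with hkk | hkk
    · rw [← hR']
      exact twist_near_of_twist_near_of_near hvρ hvΘ hσ' hvσ' hfix' hπ' hdd' jK hjle hjΘ hjfix hjσ hjπ hDΘ hFN hΘn₀ hn₀1 hn₀N hkr hkk hκ1
        ⟨ω, hω, by rw [hR'']; exact hle⟩ (hTE hc hk' hadm')
    · refine ⟨ω, hω, hle.trans ?_⟩
      rw [exp_le_exp]; omega

/-- **CLASS E BEYOND THE THRESHOLD, AGAINST A REFERENCE FAR CELL**: the mirror statement for the anchored class. [cite: Serre1979, Ch. V §3 Prop. 5, Cor. 3] -/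
theorem anchoredNear_iff_depth_and_ref_of_threshold_le [CompleteSpace K] [Finite 𝓀[K]]
    (hD : IsRamifiedQuadraticDatum ρ α dρ t) (hΘρ : ∀ x, Θ (ρ x) = ρ (Θ x)) (hvΘ : ∀ x, Valued.v (Θ x) = Valued.v x)
    (hτ : ∀ x, τ x = Θ (ρ x)) (hDτ : IsRamifiedQuadraticDatum τ α dτ tτ)
    {P : K} (hτP : τ P = P) (hP : Valued.v P = exp (-2 : ℤ)) {dK : ℕ} (hdK : Valued.v (P - ρ P) = exp (-(2 * (dK : ℤ))))
    (hσ' : ∀ x, σ' (σ' x) = x) (hvσ' : ∀ x, Valued.v (σ' x) = Valued.v x) (hfix' : ∀ x : K', σ' x = x → x ≠ 0 → ∃ n : ℤ, Valued.v x = exp (2 * n))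
    (hπ' : Valued.v π' = exp (-1 : ℤ)) (hdd' : Valued.v (π' - σ' π') = Valued.v π' ^ d')
    (jK : K' →+* K) (hjle : ∀ x y : K', Valued.v (jK x) ≤ Valued.v (jK y) ↔ Valued.v x ≤ Valued.v y) (hjΘ : ∀ x, Θ (jK x) = jK x)
    (hjfix : ∀ z : K, Θ z = z → ∃ x, jK x = z) (hjσ : ∀ x, jK (σ' x) = ρ (jK x)) (hjπ : Valued.v (jK π') = exp (-2 : ℤ))
    {ϖ : K} {dΘ tΘ : ℕ} (hDΘ : IsRamifiedQuadraticDatum Θ ϖ dΘ tΘ)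
    (hFN : ∀ f : K, ρ f = f → Θ f = f → Valued.v f = 1 → ∃ x : K, x * Θ x = f)
    {n₀ : K} (hΘn₀ : Θ n₀ = n₀) (hn₀1 : Valued.v n₀ = 1) (hn₀N : ¬ ∃ z : K, z * Θ z = n₀)
    (hϖE : Valued.v ϖE = exp (-2 : ℤ)) {lam u : K} (hlam : lam * Θ lam = 1) (hu : ρ u = u) (hu1 : u * Θ u = 1)
    {m jl : ℕ} (hμ : Valued.v (lam - u) = Valued.v ϖE ^ m) (hjl : Valued.v ((lam - u) - ρ (lam - u)) = Valued.v (ϖE ^ jl * (α - ρ α)))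
    (hℓ : 2 * (d' : ℤ) + 2 * m ≤ 2 * jl + dρ)
    {c' k' : ℕ} (hc : dτ ≤ 2 * c') (hk' : 2 * ((d' : ℤ) + k') = 2 * c' + dρ) (hk : dΘ ≤ k' + 1)
    {c'' k'' : ℕ} (hc'' : dτ ≤ 2 * c'') (hk'' : 2 * ((d' : ℤ) + k'') = 2 * c'' + dρ) (hkr : dΘ ≤ k'' + 1)
    (hadm : 2 * (c'' : ℤ) + dτ + 2 * dK ≤ 2 * jl + dρ + 2) :
    (∃ ω : K, Valued.v ω = 1 ∧
        Valued.v (ρ (lam - u) / (lam - u) * (ρ n₀ / n₀) * (ρ (ω * Θ ω) / (ω * Θ ω)) - 1) ≤ exp (-(2 * (c' : ℤ) + dρ))) ↔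
      2 * (c' : ℤ) + dτ + 2 * dK ≤ 2 * jl + dρ + 2 ∧
        ∃ ω : K, Valued.v ω = 1 ∧
          Valued.v (ρ (lam - u) / (lam - u) * (ρ n₀ / n₀) * (ρ (ω * Θ ω) / (ω * Θ ω)) - 1) ≤ exp (-(2 * (c'' : ℤ) + dρ)) := by
  obtain ⟨hρρ, hvρ, -, -, -, -, -⟩ := id hD
  have hΘΘ := hDΘ.1
  have hF4 := v_eq_exp_four_mul_of_fixed_fixed hτ hfix' hπ' jK hjle hjfix hjσ hjπ
  have hμ0 : lam - u ≠ 0 := fun h0 => by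
    rw [h0, map_zero, v_varpiE_pow hϖE] at hμ; exact exp_ne_zero hμ.symm
  have hn₀0 : n₀ ≠ 0 := fun h0 => by rw [h0, map_zero] at hn₀1; exact zero_ne_one hn₀1
  have hκ1 : Valued.v (ρ (lam - u) / (lam - u)) = 1 := (token_twist_mu hρρ hvρ hμ0).2
  have hlaw := fun {c : ℕ} (hcc : dτ ≤ 2 * c) =>
    exists_thetaFixed_normOne_near_iff_ramified hD hΘΘ hΘρ hvΘ hτ hDτ hτP hP hdK hF4 hϖE hlam hu hu1 hjl hcc
  have hR' : Valued.v (jK π' ^ (d' + k')) = exp (-(2 * (c' : ℤ) + dρ)) := by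
    rw [v_map_pow_eq_exp_neg_two_mul jK hjπ]; congr 1; push_cast; omega
  have hR'' : Valued.v (jK π' ^ (d' + k'')) = exp (-(2 * (c'' : ℤ) + dρ)) := by
    rw [v_map_pow_eq_exp_neg_two_mul jK hjπ]; congr 1; push_cast; omega
  have hTE : ∀ {c k : ℕ}, dτ ≤ 2 * c → 2 * ((d' : ℤ) + k) = 2 * c + dρ → 2 * (c : ℤ) + dτ + 2 * dK ≤ 2 * jl + dρ + 2 →
      (∃ ω : K, Valued.v ω = 1 ∧ Valued.v (ρ (lam - u) / (lam - u) * (ρ (ω * Θ ω) / (ω * Θ ω)) - 1) ≤ Valued.v (jK π' ^ (d' + k))) ∨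
        ∃ ω : K, Valued.v ω = 1 ∧
          Valued.v (ρ (lam - u) / (lam - u) * (ρ n₀ / n₀) * (ρ (ω * Θ ω) / (ω * Θ ω)) - 1) ≤ Valued.v (jK π' ^ (d' + k)) :=
    fun {c k} hcc hkk hadmc => by
      obtain ⟨x, hΘx, hx, hκx⟩ := (hlaw hcc).2 hadmc
      have hx1 := v_sub_one_le_of_near_kappa hD hϖE hμ hjl (c' := c) (by omega) hℓ hκx
      have hRc : Valued.v (jK π' ^ (d' + k)) = exp (-(2 * (c : ℤ) + dρ)) := by
        rw [v_map_pow_eq_exp_neg_two_mul jK hjπ]; congr 1; push_cast; omega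
      rw [hRc]
      exact twist_near_or_anchored_of_thetaFixed_near hvρ hvΘ hσ' hvσ' hfix' hπ' hdd' jK hjle hjΘ hjfix hjσ hjπ hDΘ hΘn₀ hn₀1 hn₀N hΘx hx hκx hx1
  constructor
  · rintro ⟨ω, hω, hle⟩
    have hω0 : ω ≠ 0 := fun h0 => by rw [h0, map_zero] at hω; exact zero_ne_one hω
    have hadm' : 2 * (c' : ℤ) + dτ + 2 * dK ≤ 2 * jl + dρ + 2 := by
      refine (hlaw hc).1 (exists_thetaFixed_normOne_near_of_twist hρρ hvρ hΘρ (y := n₀ * (ω * Θ ω))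
        (by rw [map_mul, hΘn₀, map_mul, hΘΘ, mul_comm (Θ ω)]) (mul_ne_zero hn₀0 (mul_ne_zero hω0 ((map_ne_zero Θ).2 hω0))) ?_)
      have hre : ρ (lam - u) / (lam - u) * (ρ (n₀ * (ω * Θ ω)) / (n₀ * (ω * Θ ω))) =
          ρ (lam - u) / (lam - u) * (ρ n₀ / n₀) * (ρ (ω * Θ ω) / (ω * Θ ω)) := by
        rw [map_mul ρ n₀, mul_div_mul_comm, mul_assoc]
      rw [hre]; exact hle
    refine ⟨hadm', ?_⟩
    rcases le_total k' k'' with hkk | hkk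
    · rw [← hR'']
      exact anchored_of_anchored_of_near hvρ hvΘ hσ' hvσ' hfix' hπ' hdd' jK hjle hjΘ hjfix hjσ hjπ hDΘ hFN hΘn₀ hn₀1 hn₀N hk hkk hκ1
        ⟨ω, hω, by rw [hR']; exact hle⟩ (hTE hc'' hk'' hadm)
    · refine ⟨ω, hω, hle.trans ?_⟩
      rw [exp_le_exp]; omega
  · rintro ⟨hadm', ω, hω, hle⟩
    rcases le_total k'' k' with hkk | hkk
    · rw [← hR']
      exact anchored_of_anchored_of_near hvρ hvΘ hσ' hvσ' hfix' hπ' hdd' jK hjle hjΘ hjfix hjσ hjπ hDΘ hFN hΘn₀ hn₀1 hn₀N hkr hkk hκ1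
        ⟨ω, hω, by rw [hR'']; exact hle⟩ (hTE hc hk' hadm')
    · refine ⟨ω, hω, hle.trans ?_⟩
      rw [exp_le_exp]; omega

/-! ## §4 (ED. 2) The `τ`-datum letter discharged up to its different exponent -/

/-- **`τ`-FIXED ELEMENTS HAVE EVEN VALUATION**: for `x` fixed by `τ = Θρ`, `x·ρx` is fixed by `ρ` and by `τ` (`ρx = Θx`), so `2·v(x) ∈ 4ℤ` by §1. [cite: Serre1979, Ch. II §2] -/
theorem exists_v_eq_exp_two_mul_of_tauFixed (hτ : ∀ x, τ x = Θ (ρ x)) (hρρ : ∀ x, ρ (ρ x) = x) (hvρ : ∀ x, Valued.v (ρ x) = Valued.v x)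
    (hΘΘ : ∀ x, Θ (Θ x) = x)
    (hfix' : ∀ x : K', σ' x = x → x ≠ 0 → ∃ n : ℤ, Valued.v x = exp (2 * n)) (hπ' : Valued.v π' = exp (-1 : ℤ))
    (jK : K' →+* K) (hjle : ∀ x y : K', Valued.v (jK x) ≤ Valued.v (jK y) ↔ Valued.v x ≤ Valued.v y)
    (hjfix : ∀ z : K, Θ z = z → ∃ x, jK x = z) (hjσ : ∀ x, jK (σ' x) = ρ (jK x)) (hjπ : Valued.v (jK π') = exp (-2 : ℤ))
    (x : K) (hτx : τ x = x) (hx0 : x ≠ 0) : ∃ n : ℤ, Valued.v x = exp (2 * n) := by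
  have hΘx : Θ x = ρ x := by
    have h := congrArg Θ hτx
    rw [hτ, hΘΘ] at h
    exact h.symm
  have hρN : ρ (x * ρ x) = x * ρ x := by rw [map_mul, hρρ, mul_comm]
  have hτN : τ (x * ρ x) = x * ρ x := by rw [map_mul, hτx, hτ, hρρ, hΘx]
  obtain ⟨n, hn⟩ := v_eq_exp_four_mul_of_fixed_fixed hτ hfix' hπ' jK hjle hjfix hjσ hjπ (x * ρ x) hρN hτN
    (mul_ne_zero hx0 ((map_ne_zero ρ).2 hx0))
  have hvx0 : Valued.v x ≠ 0 := (Valuation.ne_zero_iff _).2 hx0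
  obtain ⟨e, he⟩ : ∃ e : ℤ, Valued.v x = exp e := ⟨_, (exp_log hvx0).symm⟩
  refine ⟨n, ?_⟩
  rw [map_mul, hvρ, he, ← exp_add, exp_inj] at hn
  rw [he]; congr 1; omega

/-- **THE `τ`-DATUM FROM THE FRAME**: given the `ρ`-datum `(α, d_ρ, t)`, the involution `Θ` commuting with `ρ`, the third-field package, and the one NEW letter
`|α − τα| = |α|^{dτ}` with `1 ≤ dτ`, the pair `(τ, α)` is a ★ `IsRamifiedQuadraticDatum τ α dτ t` — the hypothesis `hDτ` of ★ LAW-i and of §2–§3 above.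
[cite: Serre1979, Ch. III §6 Prop. 12] [cite: Serre1979, Ch. IV §1 Prop. 3–4] -/
theorem isRamifiedQuadraticDatum_tau (hD : IsRamifiedQuadraticDatum ρ α dρ t) (hΘΘ : ∀ x, Θ (Θ x) = x) (hΘρ : ∀ x, Θ (ρ x) = ρ (Θ x))
    (hvΘ : ∀ x, Valued.v (Θ x) = Valued.v x) (hτ : ∀ x, τ x = Θ (ρ x))
    (hfix' : ∀ x : K', σ' x = x → x ≠ 0 → ∃ n : ℤ, Valued.v x = exp (2 * n)) (hπ' : Valued.v π' = exp (-1 : ℤ))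
    (jK : K' →+* K) (hjle : ∀ x y : K', Valued.v (jK x) ≤ Valued.v (jK y) ↔ Valued.v x ≤ Valued.v y)
    (hjfix : ∀ z : K, Θ z = z → ∃ x, jK x = z) (hjσ : ∀ x, jK (σ' x) = ρ (jK x)) (hjπ : Valued.v (jK π') = exp (-2 : ℤ))
    {dτ : ℕ} (hdτ : Valued.v (α - τ α) = Valued.v α ^ dτ) (hdτ1 : 1 ≤ dτ) : IsRamifiedQuadraticDatum τ α dτ t := by
  obtain ⟨hρρ, hvρ, hα, -, -, -, h2⟩ := id hD
  exact ⟨tau_tau hτ hρρ hΘΘ hΘρ, fun a => by rw [hτ, hvΘ, hvρ], hα,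
    exists_v_eq_exp_two_mul_of_tauFixed hτ hρρ hvρ hΘΘ hfix' hπ' jK hjle hjfix hjσ hjπ, hdτ, hdτ1, h2⟩

/-! ## §5 (ED. 3) The bridges from the literal (D3) bit of ★ p857665 to the class inequalities of §2–§3 -/

/-- **BRIDGE, CLASS T**: under ★ HEAD's exact unit translator `η·t(ω₀) = −1`, the literal (D3) bit of ★ `ncard_levelSetDep_top_mul_eq_of_ramified`
`∃ ω₁ ∈ U_M, |1 + (η∕κ)·t(ω₁)| ≤ exp(2m − 2a − 2j − d_ρ)` IS the class-T inequality `∃ ω ∈ U_M, |κ·t(ω) − 1| ≤ exp(2m − 2a − 2j − d_ρ)` of §2–§3 (★ `topBit_iff_exists_isOrd_of_translator`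
+ ★ `isOrd_mul_norm_iff_twist_ramified`; `exp(2m − 2a − 2j − d_ρ) = exp(−(2c′ + d_ρ))`, `c′ = j + a − m`). [cite: Jacobowitz1962, §4] [cite: Kottwitz1986BaseChangeUnits, §1 pp. 240–241] -/
theorem topBit_iff_twistNear_ramified (hD : IsRamifiedQuadraticDatum ρ α dρ t) (hvΘ : ∀ x, Valued.v (Θ x) = Valued.v x)
    (hϖE : Valued.v ϖE = exp (-2 : ℤ)) {η : K} {ω₀ : Kˣ} (hω₀ : Valued.v (ω₀ : K) = 1)
    (hη : η * (ρ ((ω₀ : K) * Θ ω₀) / ((ω₀ : K) * Θ ω₀)) = -1) {μ : K} {m : ℕ} (hμ : Valued.v μ = Valued.v ϖE ^ m) (j a : ℕ) :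
    (∃ ω₁ : Kˣ, Valued.v (ω₁ : K) = 1 ∧
        Valued.v (1 + η / (ρ μ / μ) * (ρ ((ω₁ : K) * Θ ω₁) / ((ω₁ : K) * Θ ω₁))) ≤ exp (2 * (m : ℤ) - 2 * a - 2 * j - dρ)) ↔
      ∃ ω : K, Valued.v ω = 1 ∧ Valued.v (ρ μ / μ * (ρ (ω * Θ ω) / (ω * Θ ω)) - 1) ≤ exp (2 * (m : ℤ) - 2 * a - 2 * j - dρ) := by
  rw [topBit_iff_exists_isOrd_of_translator hD hvΘ hϖE hω₀ hη hμ j a]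
  constructor
  · rintro ⟨ω, hω, hord⟩
    exact ⟨(ω : K), hω, (isOrd_mul_norm_iff_twist_ramified hD hvΘ hϖE hμ j a hω).1 hord⟩
  · rintro ⟨ω, hω, hle⟩
    have hω0 : ω ≠ 0 := fun h0 => by rw [h0, map_zero] at hω; exact zero_ne_one hω
    exact ⟨Units.mk0 ω hω0, hω, (isOrd_mul_norm_iff_twist_ramified hD hvΘ hϖE hμ j a (ω := ((Units.mk0 ω hω0 : Kˣ) : K)) hω).2 hle⟩

/-- **BRIDGE, CLASS E**: under an ANCHOR `η·t(ω₀)·(ρn₀∕n₀) = −1` (`n₀` a unit scalar; for the RamM `−` side a `Θ`-fixed unit non-norm), the literal (D3) bit IS the class-E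
inequality `∃ ω ∈ U_M, |κ·(ρn₀∕n₀)·t(ω) − 1| ≤ exp(2m − 2a − 2j − d_ρ)` (★ `topBit_iff_exists_isOrd_of_anchor` + ★ `isOrd_mul_norm_iff_twist_ramified` at `μ·n₀`).
[cite: Jacobowitz1962, §4] [cite: Kottwitz1986BaseChangeUnits, §1 pp. 240–241] -/
theorem topBit_iff_anchoredNear_ramified (hD : IsRamifiedQuadraticDatum ρ α dρ t) (hvΘ : ∀ x, Valued.v (Θ x) = Valued.v x)
    (hϖE : Valued.v ϖE = exp (-2 : ℤ)) {η n₀ : K} {ω₀ : Kˣ} (hω₀ : Valued.v (ω₀ : K) = 1) (hn₀ : Valued.v n₀ = 1)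
    (hη : η * (ρ ((ω₀ : K) * Θ ω₀) / ((ω₀ : K) * Θ ω₀)) * (ρ n₀ / n₀) = -1) {μ : K} {m : ℕ} (hμ : Valued.v μ = Valued.v ϖE ^ m) (j a : ℕ) :
    (∃ ω₁ : Kˣ, Valued.v (ω₁ : K) = 1 ∧
        Valued.v (1 + η / (ρ μ / μ) * (ρ ((ω₁ : K) * Θ ω₁) / ((ω₁ : K) * Θ ω₁))) ≤ exp (2 * (m : ℤ) - 2 * a - 2 * j - dρ)) ↔
      ∃ ω : K, Valued.v ω = 1 ∧
        Valued.v (ρ μ / μ * (ρ n₀ / n₀) * (ρ (ω * Θ ω) / (ω * Θ ω)) - 1) ≤ exp (2 * (m : ℤ) - 2 * a - 2 * j - dρ) := by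
  have hμ' : Valued.v (μ * n₀) = Valued.v ϖE ^ m := by rw [map_mul, hn₀, mul_one, hμ]
  have hκ' : ρ (μ * n₀) / (μ * n₀) = ρ μ / μ * (ρ n₀ / n₀) := by rw [map_mul, mul_div_mul_comm]
  rw [topBit_iff_exists_isOrd_of_anchor hD hvΘ hϖE hω₀ hn₀ hη hμ j a]
  constructor
  · rintro ⟨ω, hω, hord⟩
    have h := (isOrd_mul_norm_iff_twist_ramified hD hvΘ hϖE hμ' j a hω).1 hord
    rw [hκ'] at h
    exact ⟨(ω : K), hω, h⟩
  · rintro ⟨ω, hω, hle⟩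
    have hω0 : ω ≠ 0 := fun h0 => by rw [h0, map_zero] at hω; exact zero_ne_one hω
    refine ⟨Units.mk0 ω hω0, hω, (isOrd_mul_norm_iff_twist_ramified hD hvΘ hϖE hμ' j a (ω := ((Units.mk0 ω hω0 : Kˣ) : K)) hω).2 ?_⟩
    rw [hκ']; exact hle

end Summit.HodgeConjecture.HodgeConjecture.Cruxes.H413.F0P3cDyRamToricLevelCensusRamM

end
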